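import Summits.BirchSwinnertonDyer.Rank1Residual.Additive.QuadraticBranchEvenExactControlDischarge
import Summits.BirchSwinnertonDyer.Rank1Residual.Additive.QuadraticBranchEvenReadingsOfEta
import HarnessLib

/-!
# `ord_p #Ш(W) = ord_p #Ш(W)_an` EXACTLY on every Gss2 rank-0 row `p ≥ 5` from the even exact control:
# the rank-`0` half of the K8 route's `Gss2Assembly` (cell `bsd-potss`, seat `bsd-potss-ctrl` g2;
# consumer of R-ctrl-17 `…ExactControlDischarge` + the value identity + the η-component readings)

HONEST FRAMING (cell `bsd-potss`, run/shared/lean/pub/bsd-potss/; FULL-BSD rank ≤ 1 programme,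
tranche 1b): TOOL THEOREMS ONLY — no definition, no named Literature fact introduced, no `sorry`, axioms
standard. CONDITIONAL on the displayed inputs: GZK (`rank_eq_analyticRank_of_analyticRank_le_one`),
modularity (`hasEntireLFunction_rat`), Poitou–Tate (`poitouTate_selmerStructure_duality_real ℚ`), the
typed node / the readings (R1⁺)+(R2⁺) / their verbatim η-component frames `hMC`, `hKO`, and (C1_η)
`QuadraticBranchPlusMainConjectureAt V p` as `h1`; the existence side-lemmas (newform `f`, period ratio
`ϖ`, branch function `L`) stay BINDERS as in file 6. NO Kato input, NO image hypothesis, NO Tamagawa or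
Manin side condition. Nothing is booked; no label / mark / count moves; `BSD(W, p)` is NOT claimed for
any pair (every input is displayed).

## What
* `missingPPartAt_rankZero_of_selmer_eq` — bookkeeping: `L(W,1) ≠ 0`, `L(W,1)/Ω_W = q`,
  `v_p(q) = ord_p #Sel_{p^∞}(W/ℚ) + ord_p(Tam/#tors²)` ⟹ `MissingPPartAt W p` (file 6 §1 with `=`).
* `missingPPartAt_rankZero_of_exactControl` — the typed node `QuadraticBranchEvenExactControlOfPlusMCAt W p`
  + the value identity `v_p(L_p⁺(V,η,0)) = v_p(L(W,1)/Ω_W)` ⟹ `MissingPPartAt W p` in analytic rank `0`.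
* **`missingPPartAt_rankZero_of_readings (hPT) (hGZK) (hmod) (hR1) (hR2)`** and
  **`missingPPartAt_rankZero_of_plusMCEta_of_kitajimaOtsuki13PlusEta (hPT) (hGZK) (hmod) (hMC) (hKO)`** —
  the node discharged (R-ctrl-17) resp. the readings discharged (T-e2-R1⁺ piece (ii)); and
  `bsdp_rankZero_of_readings` (Miller's `BSD(W,p)` via `bsdp_of_missingPPartAt`).

References: [Kobayashi2003] §4 (p. 8), Thm. 9.3 (p. 26), (3.6) (p. 7); [Miller2011LMS] §1, Def. 1.1;
[GreenbergLNM1716] §4 Thm. 4.1; [MilneADT2006] I Thm. 4.10.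
-/

noncomputable section

open scoped Classical MatrixGroups ModularForm

open CongruenceSubgroup Field Function NumberField IsDedekindDomain WeierstrassCurve
open Literature.NumberTheory.EllipticCurves
open Literature.NumberTheory.EllipticCurves.ModularForms
open Literature.NumberTheory.EllipticCurves.Kobayashi2003
open Literature.NumberTheory.EllipticCurves.Rank1Residual
open Literature.NumberTheory.EllipticCurves.Rank1Residual.Typed
open Literature.NumberTheory.GaloisRepresentations
open Literature.NumberTheory.GaloisCohomology
open Literature.NumberTheory.EllipticCurves.IwasawaAlgebra
open Literature.NumberTheory.EllipticCurves.IwasawaDual ZpExtension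

namespace Summit.BirchSwinnertonDyer.Rank1Residual.Additive

namespace EvenControlZero

variable (W : WeierstrassCurve ℚ) [W.IsElliptic] [W.IsGloballyMinimal] (p : ℕ) [hp : Fact p.Prime]

/-- **Rank-`0` bookkeeping, exact form.** If `L(W,1) ≠ 0`, `L(W,1)/Ω_W = q ∈ ℚ`, and
`v_p(q) = ord_p #Sel_{p^∞}(W/ℚ) + ord_p(Tam(W)/#W(ℚ)_tors²)`, then `ord_p #Ш(W)_an = ord_p #Ш(W)`
(`Typed.MissingPPartAt W p`): GZK gives `rank W(ℚ) = 0` and `Ш(W)` finite, `#Sel_{p^∞} = #Ш[p^∞]`,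
`ord_p #Ш[p^∞] = ord_p #Ш`, `#Ш_an = q·#W(ℚ)²/Tam(W)`. [cite: Miller2011LMS, §1 and Def. 1.1]
[cite: GreenbergLNM1716, §1 p. 54 and §4 p. 103] -/
theorem missingPPartAt_rankZero_of_selmer_eq
    (hGZK : rank_eq_analyticRank_of_analyticRank_le_one) (hL : W.entireLFunction 1 ≠ 0) {q : ℚ}
    (hq : W.entireLFunction 1 / (W.realPeriodRat : ℂ) = (q : ℂ))
    (heq : padicValRat p q = (padicValNat p (Nat.card ↥(W.selmerGroupPInfty p)) : ℤ) +
      padicValRat p ((W.tamagawaProduct : ℚ) / (W.torsionOrder : ℚ) ^ 2)) :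
    MissingPPartAt W p := by
  obtain ⟨hmw0, hE, hfin, hshaAn⟩ := Wuthrich2014.shaAn_eq_of_L_one_div_eq hGZK W hL hq
  haveI := hE
  haveI := hfin
  have hΩ : (W.realPeriodRat : ℂ) ≠ 0 := by exact_mod_cast W.realPeriodRat_pos_holds.ne'
  have hq0 : q ≠ 0 := by
    rintro rfl
    apply hL
    have h := hq
    rw [Rat.cast_zero, div_eq_zero_iff] at h
    exact h.resolve_right hΩ
  have hT0 : W.torsionOrder ≠ 0 := W.torsionOrder_pos_holds.ne'
  have hTq : (W.torsionOrder : ℚ) ≠ 0 := by exact_mod_cast hT0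
  have hPq : (W.tamagawaProduct : ℚ) ≠ 0 := by exact_mod_cast W.tamagawaProduct_pos_holds.ne'
  have hcardT : (Nat.card W.toAffine.Point : ℚ) = (W.torsionOrder : ℚ) := by
    rw [W.torsionOrder_eq_natCard_of_finite]
  refine ⟨q * (Nat.card W.toAffine.Point : ℚ) ^ 2 / (W.tamagawaProduct : ℚ), hshaAn, ?_⟩
  rw [hcardT, padicValRat.div (mul_ne_zero hq0 (pow_ne_zero 2 hTq)) hPq,
    padicValRat.mul hq0 (pow_ne_zero 2 hTq), padicValRat.pow]
  rw [padicValRat.div hPq (pow_ne_zero 2 hTq), padicValRat.pow] at heq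
  have hSel := W.natCard_selmerGroupPInfty_eq_natCard_primaryComponent_sha p
  have hSha : padicValNat p (Nat.card (AddCommGroup.primaryComponent W.sha p)) =
      padicValNat p W.shaOrder := by
    rw [WeierstrassCurve.shaOrder, padicValNat_card_addPrimaryComponent]
  rw [hSel, hSha] at heq
  linarith

/-- **`MissingPPartAt W p` in analytic rank `0` from the typed node T-e2-r0** (`QuadraticBranchEvenExactControlOfPlusMCAt
W p`, B. D. Kim's formula at `η`: `ord_p #Sel + ord_p(Tam/#tors²) = v_p(L_p⁺(V,η,0))`) and the value
identity (`v_p(L_p⁺(V,η,0)) = v_p(L(W,1)/Ω_W)`, this seat's `QuadraticBranchEvenValueIdentity`), for the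
good `a_p = 0` twin `V` with (C1_η), its newform `f`, the period ratio `ϖ` and any plus branch function
`L`; `L(W,1) ≠ 0`. CONDITIONAL on the displayed inputs; nothing booked.
[cite: Kobayashi2003, Thm. 9.3 (p. 26), (3.6) (p. 7), §4 (p. 8)] [cite: Miller2011LMS, Def. 1.1] -/
theorem missingPPartAt_rankZero_of_exactControl
    (hGZK : rank_eq_analyticRank_of_analyticRank_le_one) (hmod : hasEntireLFunction_rat)
    (hEx : QuadraticBranchEvenExactControlOfPlusMCAt W p)
    (V : WeierstrassCurve ℚ) [V.IsElliptic] [V.IsGloballyMinimal] (C : VariableChange ℚ)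
    {N : ℕ} [NeZero N] {f : CuspForm (Gamma0 N) 2}
    (hp5 : 5 ≤ p) (hCV : C • W.quadraticTwist ((-1) ^ (p / 2) * p) = V)
    (hgood : V.HasGoodReductionAtPrime p) (hap : V.frobeniusTrace p = 0)
    (h1 : QuadraticBranchPlusMainConjectureAt V p) (hf : IsNewformOf V f) {ϖ : ℚ}
    (hϖ : if Even (p / 2) then (ϖ : ℝ) * V.realPeriodRat = plusPeriod f
      else (ϖ : ℝ) * V.imaginaryPeriodRat = minusPeriod f)
    {L : IwasawaAlgebra p} (hL : IsQuadraticBranchPlusLFunction f p ϖ L)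
    (hLW : W.entireLFunction 1 ≠ 0) :
    MissingPPartAt W p := by
  have hp2 : p ≠ 2 := by omega
  obtain ⟨q, hq⟩ := exists_rat_entireLFunction_one_div_of_twist W p hmod hp2 V C hCV hgood hf hϖ
  obtain ⟨hval, h0⟩ := valuation_constantCoeff_eq_padicValRat_of_twist p hmod hp2 W V C hCV hgood hf hϖ hL hq
  obtain ⟨-, heq⟩ := hEx V C hp5 hCV hgood hap h1 hf ϖ hϖ L hL (h0 hLW)
  rw [hval] at heq
  exact missingPPartAt_rankZero_of_selmer_eq W p hGZK hLW hq heq.symm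

/-- **`MissingPPartAt W p` on EVERY Gss2 rank-0 row `p ≥ 5` from `hPT` + (R1⁺) + (R2⁺) + (C1_η) + GZK +
modularity** — the node discharged by R-ctrl-17 (`quadraticBranchEvenExactControlOfPlusMCAt_of_readings`).
NO Kato input, NO image / Tamagawa / Manin condition. CONDITIONAL on the displayed inputs; nothing booked.
[cite: Kobayashi2003, §4 (p. 8), Thm. 9.3 with (9.33) (pp. 26–27)] [cite: KitajimaOtsuki2018, Main Thm. 1.3]
[cite: MilneADT2006, I Thm. 4.10] [cite: Miller2011LMS, Def. 1.1] -/
theorem missingPPartAt_rankZero_of_readings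
    (hPT : poitouTate_selmerStructure_duality_real ℚ)
    (hGZK : rank_eq_analyticRank_of_analyticRank_le_one) (hmod : hasEntireLFunction_rat)
    (hR1 : EvenBranchPlusCharIdealOfPlusMCAt W p) (hR2 : EvenBranchPlusNoFiniteSubmoduleAt W p)
    (V : WeierstrassCurve ℚ) [V.IsElliptic] [V.IsGloballyMinimal] (C : VariableChange ℚ)
    {N : ℕ} [NeZero N] {f : CuspForm (Gamma0 N) 2}
    (hp5 : 5 ≤ p) (hCV : C • W.quadraticTwist ((-1) ^ (p / 2) * p) = V)
    (hgood : V.HasGoodReductionAtPrime p) (hap : V.frobeniusTrace p = 0)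
    (h1 : QuadraticBranchPlusMainConjectureAt V p) (hf : IsNewformOf V f) {ϖ : ℚ}
    (hϖ : if Even (p / 2) then (ϖ : ℝ) * V.realPeriodRat = plusPeriod f
      else (ϖ : ℝ) * V.imaginaryPeriodRat = minusPeriod f)
    {L : IwasawaAlgebra p} (hL : IsQuadraticBranchPlusLFunction f p ϖ L)
    (hLW : W.entireLFunction 1 ≠ 0) :
    MissingPPartAt W p :=
  missingPPartAt_rankZero_of_exactControl W p hGZK hmod
    (quadraticBranchEvenExactControlOfPlusMCAt_of_readings W p hPT hR1 hR2) V C hp5 hCV hgood hap h1 hf hϖ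
    hL hLW

/-- **`MissingPPartAt W p` on every Gss2 rank-0 row `p ≥ 5` from the VERBATIM η-component frames**
`hMC` (Kobayashi's even MC at `η`, read on top of (C1_η) — the plus conjunct of the K8 crux
`EtaTransportSigned` at `p`) and `hKO` (Kitajima–Otsuki Main Thm. 1.3, sign `+`, `η`-part) + `hPT` + GZK +
modularity: the readings discharged by `SignedTwist.evenBranchPlusCharIdealOfPlusMCAt_of_plusMCEta` /
`…NoFiniteSubmoduleAt_of_kitajimaOtsuki13PlusEta`. CONDITIONAL on the displayed inputs; nothing booked.
[cite: Kobayashi2003, §4 (p. 8), Thm. 9.3 (p. 26)] [cite: KitajimaOtsuki2018, Main Thm. 1.3] [cite: Miller2011LMS, Def. 1.1] -/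
theorem missingPPartAt_rankZero_of_plusMCEta_of_kitajimaOtsuki13PlusEta
    (hPT : poitouTate_selmerStructure_duality_real ℚ)
    (hGZK : rank_eq_analyticRank_of_analyticRank_le_one) (hmod : hasEntireLFunction_rat)
    (hMC : ∀ (K₀ : Type) [Field K₀] [NumberField K₀] [IsCyclotomicExtension {p} ℚ K₀]
        [(galRange (K := ℚ) K₀).Normal] (ηq : absoluteGaloisGroup ℚ →* ℤˣ),
        (∀ σ ∈ galRange (K := ℚ) K₀, ηq σ = 1) → ηq ≠ 1 →
      ∀ (V : WeierstrassCurve ℚ) [V.IsElliptic] [V.IsGloballyMinimal] {N : ℕ} [NeZero N]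
        {f : CuspForm (Gamma0 N) 2},
        p ≠ 2 → V.HasGoodReductionAtPrime p → V.frobeniusTrace p = 0 →
        QuadraticBranchPlusMainConjectureAt V p → IsNewformOf V f →
      ∀ (ϖ : ℚ), (if Even (p / 2) then (ϖ : ℝ) * V.realPeriodRat = plusPeriod f
          else (ϖ : ℝ) * V.imaginaryPeriodRat = minusPeriod f) →
      ∀ (Lη : IwasawaAlgebra p), IsQuadraticBranchPlusLFunction f p ϖ Lη →
      ∀ (κ : ZpExtension ℚ p) (γ : absoluteGaloisGroup ℚ),
        κ.IsCyclotomic → κ.IsTopGenerator γ → γ ∈ galRange (K := ℚ) K₀ →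
        IsCyclotomicVariable p γ →
      ∀ (D : EtaSignedSelmerDualData V κ K₀ ℚ_[p] ηq γ 1),
        Module.Finite (IwasawaAlgebra p) D.X ∧ Module.IsTorsion (IwasawaAlgebra p) D.X ∧
          D.charIdeal = Ideal.span {Lη})
    (hKO : ∀ (K₀ : Type) [Field K₀] [NumberField K₀] [IsCyclotomicExtension {p} ℚ K₀]
        [(galRange (K := ℚ) K₀).Normal] (ηq : absoluteGaloisGroup ℚ →* ℤˣ),
        (∀ σ ∈ galRange (K := ℚ) K₀, ηq σ = 1) →
      ∀ (V : WeierstrassCurve ℚ) [V.IsElliptic] [V.IsGloballyMinimal],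
        p ≠ 2 → V.HasGoodReductionAtPrime p → V.frobeniusTrace p = 0 →
      ∀ (κ : ZpExtension ℚ p) (γ : absoluteGaloisGroup ℚ),
        κ.IsCyclotomic → κ.IsTopGenerator γ → γ ∈ galRange (K := ℚ) K₀ →
      ∀ (D : EtaSignedSelmerDualData V κ K₀ ℚ_[p] ηq γ 1),
        Module.Finite (IwasawaAlgebra p) D.X → Module.IsTorsion (IwasawaAlgebra p) D.X →
        ∀ M : Submodule (IwasawaAlgebra p) D.X, Finite M → M = ⊥)
    (V : WeierstrassCurve ℚ) [V.IsElliptic] [V.IsGloballyMinimal] (C : VariableChange ℚ)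
    {N : ℕ} [NeZero N] {f : CuspForm (Gamma0 N) 2}
    (hp5 : 5 ≤ p) (hCV : C • W.quadraticTwist ((-1) ^ (p / 2) * p) = V)
    (hgood : V.HasGoodReductionAtPrime p) (hap : V.frobeniusTrace p = 0)
    (h1 : QuadraticBranchPlusMainConjectureAt V p) (hf : IsNewformOf V f) {ϖ : ℚ}
    (hϖ : if Even (p / 2) then (ϖ : ℝ) * V.realPeriodRat = plusPeriod f
      else (ϖ : ℝ) * V.imaginaryPeriodRat = minusPeriod f)
    {L : IwasawaAlgebra p} (hL : IsQuadraticBranchPlusLFunction f p ϖ L)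
    (hLW : W.entireLFunction 1 ≠ 0) :
    MissingPPartAt W p :=
  missingPPartAt_rankZero_of_readings W p hPT hGZK hmod
    (SignedTwist.evenBranchPlusCharIdealOfPlusMCAt_of_plusMCEta W p hMC)
    (SignedTwist.evenBranchPlusNoFiniteSubmoduleAt_of_kitajimaOtsuki13PlusEta W p hKO)
    V C hp5 hCV hgood hap h1 hf hϖ hL hLW

/-- **`BSD(W, p)` (Miller) on every Gss2 pair of analytic rank `0`, `p ≥ 5`, from `hPT` + (R1⁺) + (R2⁺)
+ (C1_η) + GZK + modularity** (`Typed.bsdp_of_missingPPartAt`); `L(W,1) ≠ 0` from `r_an(W) = 0` and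
modularity. CONDITIONAL on the displayed inputs; nothing booked.
[cite: Kobayashi2003, §4 (p. 8), Thm. 9.3 (p. 26)] [cite: Miller2011LMS, §1 and Def. 1.1] -/
theorem bsdp_rankZero_of_readings
    (hPT : poitouTate_selmerStructure_duality_real ℚ)
    (hGZK : rank_eq_analyticRank_of_analyticRank_le_one) (hmod : hasEntireLFunction_rat)
    (hR1 : EvenBranchPlusCharIdealOfPlusMCAt W p) (hR2 : EvenBranchPlusNoFiniteSubmoduleAt W p)
    (V : WeierstrassCurve ℚ) [V.IsElliptic] [V.IsGloballyMinimal] (C : VariableChange ℚ)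
    {N : ℕ} [NeZero N] {f : CuspForm (Gamma0 N) 2}
    (hp5 : 5 ≤ p) (hCV : C • W.quadraticTwist ((-1) ^ (p / 2) * p) = V)
    (hgood : V.HasGoodReductionAtPrime p) (hap : V.frobeniusTrace p = 0)
    (h1 : QuadraticBranchPlusMainConjectureAt V p) (hf : IsNewformOf V f) {ϖ : ℚ}
    (hϖ : if Even (p / 2) then (ϖ : ℝ) * V.realPeriodRat = plusPeriod f
      else (ϖ : ℝ) * V.imaginaryPeriodRat = minusPeriod f)
    {L : IwasawaAlgebra p} (hL : IsQuadraticBranchPlusLFunction f p ϖ L)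
    (hr : W.analyticRank = 0) : BSDp W p := by
  have hLW : W.entireLFunction 1 ≠ 0 := by
    rw [← W.leadingLCoeff_eq_of_analyticRank_eq_zero hr]
    exact W.leadingLCoeff_ne_zero_holds (hmod W)
  exact bsdp_of_missingPPartAt W p hGZK (by rw [hr]; exact zero_le_one)
    (missingPPartAt_rankZero_of_readings W p hPT hGZK hmod hR1 hR2 V C hp5 hCV hgood hap h1 hf hϖ hL hLW)

end EvenControlZero

end Summit.BirchSwinnertonDyer.Rank1Residual.Additive

end
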